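import Summits.BirchSwinnertonDyer.Rank1Residual.O5.HeegnerLogTransportThreeExactCount
import HarnessLib
import HarnessLib.Audit.Tags

/-!
# O5 / C-KL3-V — KL3 part 10b: KL3-G `GoodBaseSelmerCountThree` is a THEOREM modulo the two textbook facts
# (Poitou–Tate duality for Selmer structures, local Euler characteristic), and the same exact count at the
# ADDITIVE prime `3` with `3 ∤ c₃` (cell `b2b-bsdres`, seat o5-r2, GEN 21)

HONEST FRAMING (verbatim, cell `b2b-bsdres`, run/shared/lean/b2b/bsd-rank1-residual/): research route; O5
(tame potentially-supersingular additive `p = 3`, reading (t′)) is OPEN. A census is EVIDENCE toward the law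
the cell is hunting, never a Literature fact. Nothing here is booked in Literature; no RESIDUAL-MAP mark moves.

## What this file does

Part 10a (`O5/HeegnerLogTransportThreeExactCount.lean`) proves the exact base Selmer count
`natCard_selmerAcBase_eq_pow_of_noLocalTorsion` at a rank-one datum under (iv), every prime, every reduction
type, modulo the two textbook facts. Here:

§2 `goodBaseSelmerCountThree_of_facts` — **KL3-G PROVED modulo the two textbook facts**: part 10a at `p = 3`
for the good companion `G` (`c₃(G) = 1`, `#G̃_ns(𝔽₃) = #G̃(𝔽₃) = nsCount G 3`, tree lemmas of parts 1/3), which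
is the statement `GoodBaseSelmerCountThree` of part 4 on the nose. Hence the consumed direction
`sha_trivial_and_klLog_eq_of_selmer_trivial` (part 4) holds with `hG` discharged:
`sha_trivial_and_klLog_eq_of_selmer_trivial_of_facts`.

§3 `selmerAcBase_eq_pow_of_addv` — the same count at the ADDITIVE prime `3` with `3 ∤ c₃` (reading (t′):
`#W̃_ns(𝔽₃) = 3`, so `e = ord₃ log_ω`): the content of KL3-B `O5BaseSelmerCountThree` under the extra displayed
hypothesis `3 ∤ c₃(W)` and with `rank W(K) = 1`, `Ш(W/K)` finite as inputs (KL3-B itself quantifies over a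
Heegner datum without a Tamagawa hypothesis and is NOT asserted here; it stays an un-consumed candidate).

NET for the KL3 chain after GEN 21 (memo `HOME/b2b-bsdres-o5-r2/gen21/O5-GEN21.md` §3): with parts 8–10
NEITHER base-Selmer node (KL3-B, KL3-G) is a typed input of the END any more; the remaining displayed inputs
of the best END (part 9 `o5_index_unit_of_ordinary_companion_facts`) are KL3-A
(`KrizLiUnitBitTransportThree`, print: Kriz–Li Thm. 1.16 / Rem. 1.17), the textbook facts
`poitouTate_selmerStructure_duality` / `localEulerPoincareCharacteristic`, the named facts (modularity,
Gross–Zagier, Kolyvagin, Yan–Zhu 4.15, Wuthrich Lemma 20), the per-row data and the STEP-0 identity.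
O5 OPEN; nothing booked; census = EVIDENCE.

References: [JetchevSkinnerWan2017] Prop. 3.2.1, §7.1 (7.1.5) (arXiv:1512.06894 pp. 10–11, 15–16);
[Castella2018] Def. 2.2 (arXiv:1704.06608 p. 5); [SilvermanAEC2009] VII.2.1, VII.6.1; [TateLNM476] §1, §6;
cell files `O5/HeegnerLogTransportThreeExactCount.lean` (part 10a), `O5/HeegnerLogTransportThreeOrdSelmer.lean`
(part 4: `GoodBaseSelmerCountThree`, `sha_trivial_and_klLog_eq_of_selmer_trivial`), `O5/HeegnerLogTransportThree.lean`
(part 1: `nsCount`, `NoLocalThreeTorsionAt`), `Additive/LocalLog*.lean` (`reductionPointCount_of_addv`).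

## TYPER PLACEMENT NOTE

Imports part 10a `O5/HeegnerLogTransportThreeExactCount.lean` (o5-r2 GEN 21, to be placed first) and nothing
else outside the tree; part 9 (`O5/HeegnerLogTransportThreeResidualEndFacts.lean`) imports THIS file by its
module name. THEOREMS only, namespace `Summit.BirchSwinnertonDyer.Rank1Residual.O5.HeegnerLogTransport`; no
`def`. Checked jointly with part 10a (scratch concatenation, `lean check` rc 0, 0 sorries, 0 warnings; axioms
`propext`, `Classical.choice`, `Quot.sound`) (o5-r2 GEN 21).

## TYPER PLACEMENT NOTE (cc-typer-5 GEN 18 = O5 §3.5 / O6 §3.4 typer of record; by-name ask A-O5-G21-1 of o5-r2 GEN 21, HOME/INBOX.md l.13972: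
'AFTER part 7, place by sha … parts 8, 10a, 10b, 9 — every file ≤ 353 l.')

Source: `HOME/b2b-bsdres-o5-r2/gen21/lean/HeegnerLogTransportThreeGoodSelmer.lean` sha16 `90bd3746eb48cae2` (169 l.; `gen21/SHA16.txt`; o5-r2's `lean check` rc 0 / 0 warnings and joint scratch
`gen21/lean/scratch/scratch_p7_8_10ab_9.lean` b9f2316600933a64 rc 0, axioms of `o5_index_unit_of_ordinary_companion_facts` std), re-hashed by the typer right before writing;
THIS file = KL3 part 10b = the source VERBATIM + this paragraph (imports, module text, every declaration block byte-identical; script `class-closure/typer-5/gen18/g21_place.py`);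
the typer's own joint farm check of parts 7 (R2) + 8 + 10a + 10b + 9 over the tree: rc 0 / 0 warnings, axioms std; DEDUP `lean search --decl` on the new names: no match.
CONTENT LABELS (sources, unchanged): THEOREMS ONLY — 0 `def`, 0 `@[conjecture]`, 0 Literature facts (net named-fact debt 0), no `sorry`; published inputs stay displayed
hypotheses by NAME (`poitouTate_selmerStructure_duality`, `localEulerPoincareCharacteristic`, `gross_zagier`, `kolyvagin`, Yan–Zhu A10, Wuthrich L20, modularity) and the ONE
typed node on the END's path is KL3-A `KrizLiUnitBitTransportThree` (part 1, p340741); KL3-B / KL3-G are NOT re-worded (their consumed directions are PROVED here / in part 10b).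
KL3 parts in the tree: 1–3 p340741 / p341262 / p341640, Global p342632, OrdCompanion p343587 + p344465, OrdSelmer p345030 + p345686, OrdTwist p346273, Residual Engine p347366 +
Residual p348865 (+ End), Literature index lemma p344022.  HONEST FRAMING (cell `b2b-bsdres`): research route, lane CLASS-CLOSURE §3.5 O5; nothing asserted beyond the displayed
binders, nothing booked, no mark of `RESIDUAL-MAP.md` moves; census = EVIDENCE, never a Literature fact; O5 OPEN.
-/

set_option autoImplicit false

noncomputable section

open scoped Classical

open WeierstrassCurve NumberField IsDedekindDomain Field
open Literature.NumberTheory.EllipticCurves Literature.NumberTheory.EllipticCurves.GreenbergSelmer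
  Literature.NumberTheory.EllipticCurves.ModularForms
  Literature.NumberTheory.EllipticCurves.Rank1Residual
  Literature.NumberTheory.EllipticCurves.Rank1Residual.Typed
  Literature.NumberTheory.GaloisRepresentations Literature.NumberTheory.GaloisCohomology

namespace Summit.BirchSwinnertonDyer.Rank1Residual.O5.HeegnerLogTransport

section KL3G

open Summit.BirchSwinnertonDyer.Rank1Residual.X11b (padicLogOrd embAt)
open Summit.BirchSwinnertonDyer.Rank1Residual.X11b.AcSelmer (selmerAcBase)

/-! ## §2 KL3-G PROVED modulo the two textbook facts -/

/-- **KL3-G `GoodBaseSelmerCountThree` is a THEOREM modulo Poitou–Tate duality for Selmer structures and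
the local Euler characteristic** (both tree named facts, displayed as hypotheses): part 10a §1 at `p = 3` for a curve
with GOOD reduction at `3` (`c₃ = 1`, `#G̃_ns(𝔽₃) = #G̃(𝔽₃) = nsCount G 3`). Nothing booked.
[cite: JetchevSkinnerWan2017, Prop. 3.2.1 and (7.1.5) (arXiv:1512.06894 pp. 10–11, 15–16)]
[cite: MilneADT2006, Ch. I, Thm. 4.10 and Thm. 2.8] [cite: SilvermanAEC2009, Exercise 8.19(a) (p. 230)] -/
theorem goodBaseSelmerCountThree_of_facts
    (hPT : ∀ (K : Type) [Field K] [NumberField K], poitouTate_selmerStructure_duality K)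
    (hEP : ∀ (K : Type) [Field K] [NumberField K] (v : HeightOneSpectrum (𝓞 K)),
      localEulerPoincareCharacteristic (v.adicCompletion K)) :
    GoodBaseSelmerCountThree := by
  intro G _ _ hgood ht K _ _ hK htors hrank hfin P hP 𝔭 h𝔭 he hf
  have hiv : ∀ R : (G.baseChange ℚ_[3]).toAffine.Point, 3 • R = 0 → R = 0 :=
    (noLocalThreeTorsionAt_iff_forall_three_nsmul G 3).mp ht
  obtain ⟨hfinSel, a, hcard, ha⟩ := natCard_selmerAcBase_eq_pow_of_noLocalTorsion G 3 hiv K hK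
    (hPT K) (hEP K) hrank hfin P hP 𝔭 h𝔭 he hf
  have hc : (G.baseChange ℚ_[3]).localTamagawaNumber ℤ_[3] = 1 :=
    localTamagawaNumber_padic_eq_one_of_good_holds G 3 hgood
  have hns : ((padicValNat 3 (reductionPointCount G 3) : ℕ) : ℤ) = padicValInt 3 (nsCount G 3) := by
    rw [nsCount_eq_reductionPointCount_of_good G 3 hgood, padicValInt.of_nat]
  refine ⟨a, ⟨hfinSel, hcard⟩, ?_⟩
  rw [ha, hc, ← hns]
  simp only [padicValNat_one_right, CharP.cast_eq_zero, add_zero]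

/-- **The consumed direction with `hG` DISCHARGED**: part 4's `sha_trivial_and_klLog_eq_of_selmer_trivial`
modulo the two textbook facts instead of the typed node KL3-G. [cite: JetchevSkinnerWan2017, Prop. 3.2.1 and (7.1.5) (arXiv:1512.06894 pp. 10–11, 16)]
[cite: MilneADT2006, Ch. I, Thm. 4.10 and Thm. 2.8] -/
theorem sha_trivial_and_klLog_eq_of_selmer_trivial_of_facts
    (hPT : ∀ (K : Type) [Field K] [NumberField K], poitouTate_selmerStructure_duality K)
    (hEP : ∀ (K : Type) [Field K] [NumberField K] (v : HeightOneSpectrum (𝓞 K)),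
      localEulerPoincareCharacteristic (v.adicCompletion K))
    (G : WeierstrassCurve ℚ) [G.IsElliptic] [G.IsGloballyMinimal] (hgood : G.HasGoodReductionAtPrime 3)
    (ht : NoLocalThreeTorsionAt G 3) (K : Type) [Field K] [NumberField K] (hK : IsImaginaryQuadratic K)
    (htors : ∀ R : (G.baseChange K).toAffine.Point, 3 • R = 0 → R = 0)
    (hrank : (G.baseChange K).mordellWeilRank = 1) (hfin : (G.baseChange K).ShaFinite)
    (P : (G.baseChange K).toAffine.Point) (hP : ¬ IsOfFinAddOrder P)
    (hI0 : (AddSubgroup.zmultiples P).index ≠ 0)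
    (𝔭 : HeightOneSpectrum (𝓞 K)) (h𝔭 : ((3 : ℕ) : 𝓞 K) ∈ 𝔭.asIdeal)
    (he : 𝔭.asIdeal.ramificationIdx (𝓞 ℚ) = 1) (hf : 𝔭.asIdeal.inertiaDeg (𝓞 ℚ) = 1)
    (hSel : Nat.card (selmerAcBase (G.baseChange K) 3 𝔭 ∅) = 1) :
    Nat.card (AddCommGroup.primaryComponent (G.baseChange K).sha 3) = 1 ∧
      padicLogOrd G 3 (embAt K 3 𝔭 h𝔭 he hf) P + padicValInt 3 (nsCount G 3) - 1 =
        (padicValNat 3 (AddSubgroup.zmultiples P).index : ℤ) :=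
  sha_trivial_and_klLog_eq_of_selmer_trivial (goodBaseSelmerCountThree_of_facts hPT hEP) G hgood ht K hK
    htors hrank hfin P hP hI0 𝔭 h𝔭 he hf hSel

end KL3G

section Additive

open Summit.BirchSwinnertonDyer.Rank1Residual.X11b (padicLogOrd embAt)
open Summit.BirchSwinnertonDyer.Rank1Residual.X11b.AcSelmer (selmerAcBase)
open Summit.BirchSwinnertonDyer.Rank1Residual.Additive.LocalLog (reductionPointCount_of_addv)

/-! ## §3 The same count at the ADDITIVE prime `3` with `3 ∤ c₃` (the content of KL3-B, rank-one inputs displayed) -/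

/-- **The exact base Selmer count at an ADDITIVE `3` with `3 ∤ c₃` and `W(ℚ₃)[3] = 0`** (reading (t′):
`#W̃_ns(𝔽₃) = 3`, so the local exponent is `ord₃ log_ω P`): `#Sel_𝔭(K, W[3^∞]) = 3^a`,
`a = ord₃ #Ш(W/K)[3^∞] + 2·(ord₃ log_ω P − ord₃ [W(K) : ℤP])` — the formula of the typed node KL3-B
`O5BaseSelmerCountThree`, here with `rank W(K) = 1`, `Ш(W/K)` finite and `3 ∤ c₃` as displayed inputs (KL3-B
itself quantifies over a Heegner datum with no Tamagawa hypothesis and is NOT asserted). CONDITIONAL on the two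
textbook facts. [cite: JetchevSkinnerWan2017, Prop. 3.2.1 and (7.1.5) (arXiv:1512.06894 pp. 10–11, 16)]
[cite: MilneADT2006, Ch. I, Thm. 4.10 and Thm. 2.8] [cite: SilvermanAEC2009, VII.6.1, Exercise 3.7] -/
theorem selmerAcBase_eq_pow_of_addv (W : WeierstrassCurve ℚ) [W.IsElliptic] [W.IsGloballyMinimal]
    (hadd : Addv W 3) (hc3 : ¬ 3 ∣ (W.baseChange ℚ_[3]).localTamagawaNumber ℤ_[3])
    (ht3 : NoLocalThreeTorsionAt W 3) (K : Type) [Field K] [NumberField K] (hK : IsImaginaryQuadratic K)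
    (hPT : poitouTate_selmerStructure_duality K)
    (hEP : ∀ v : HeightOneSpectrum (𝓞 K), localEulerPoincareCharacteristic (v.adicCompletion K))
    (hrank : (W.baseChange K).mordellWeilRank = 1) (hSha : (W.baseChange K).ShaFinite)
    (P : (W.baseChange K).toAffine.Point) (hPinf : ¬ IsOfFinAddOrder P)
    (𝔭 : HeightOneSpectrum (𝓞 K)) (h𝔭 : ((3 : ℕ) : 𝓞 K) ∈ 𝔭.asIdeal)
    (he : 𝔭.asIdeal.ramificationIdx (𝓞 ℚ) = 1) (hf : 𝔭.asIdeal.inertiaDeg (𝓞 ℚ) = 1) :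
    ∃ (_ : Finite (selmerAcBase (W.baseChange K) 3 𝔭 ∅)) (a : ℕ),
      Nat.card (selmerAcBase (W.baseChange K) 3 𝔭 ∅) = 3 ^ a ∧
      (a : ℤ) = (padicValNat 3 (Nat.card (AddCommGroup.primaryComponent (W.baseChange K).sha 3)) : ℤ) +
        2 * (padicLogOrd W 3 (embAt K 3 𝔭 h𝔭 he hf) P -
          (padicValNat 3 (AddSubgroup.zmultiples P).index : ℤ)) := by
  have hiv : ∀ R : (W.baseChange ℚ_[3]).toAffine.Point, 3 • R = 0 → R = 0 :=
    (noLocalThreeTorsionAt_iff_forall_three_nsmul W 3).mp ht3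
  obtain ⟨hfinSel, a, hcard, ha⟩ := natCard_selmerAcBase_eq_pow_of_noLocalTorsion W 3 hiv K hK hPT hEP
    hrank hSha P hPinf 𝔭 h𝔭 he hf
  have hc0 : padicValNat 3 ((W.baseChange ℚ_[3]).localTamagawaNumber ℤ_[3]) = 0 :=
    padicValNat.eq_zero_of_not_dvd hc3
  have hns : padicValNat 3 (reductionPointCount W 3) = 1 := by
    rw [reductionPointCount_of_addv W 3 hadd]; simp
  refine ⟨hfinSel, a, hcard, ?_⟩
  rw [ha, hc0, hns]
  push_cast
  ring

end Additive

end Summit.BirchSwinnertonDyer.Rank1Residual.O5.HeegnerLogTransport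

end
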